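import Summits.BirchSwinnertonDyer.Rank1Residual.Additive.X3RankZeroCyclotomicThree
import Literature.NumberTheory.EllipticCurves.Wuthrich2014.ReducibleDivisibilityCyclotomicThree
import Summits.BirchSwinnertonDyer.Rank1Residual.Additive.ChiBranchConstantTermOdd
import HarnessLib

/-!
# Line V14, corollaries: `Typed.MissingUpperBoundAt W 3` and `BSD(W,3) ∧ BSD(V,3)` on the unit rows

HONEST FRAMING (cell `b2b-bsdres`, run/shared/lean/b2b/bsd-rank1-residual/, verbatim in every
file): the goal of the cell is to DELETE the COMBINATION-SHAPED residual classes of the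
Birch–Swinnerton-Dyer formula for ALL analytic-rank `≤ 1` elliptic curves over `ℚ` — "full BSD
formula for every rank `≤ 1` curve in class `C`" assembled STRICTLY from published theorems — so
that the rank-`≤ 1` remainder becomes exactly the CONSTRUCTION-SHAPED classes, which are TYPED
(missing-input `Prop`s), NOT attempted. This is not "finishing BSD". The additive sub-cell (seats
additive-p1…p4) is a RESEARCH ROUTE on the construction-shaped classes X3/X4; no claim beyond the
stated classes; the labels of X3 (and of X1, the class of the twist pairs) are UNCHANGED by this file;
nothing is booked here (booking is the referee's call).

Theorems only; the odd-branch constant term (`hD1` of the core file) is DISCHARGED here by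
`constantCoeff_padicLFunctionMinusBranch_one_three` (`ChiBranchConstantTermOdd.lean`). Corollaries of
`X3CyclotomicThree.exists_padicVal_shaOrder_add_le`
(`X3RankZeroCyclotomicThree.lean`, whose docstring has the mathematics, the exact list of hypotheses
and the census): if `#Ш_an(V)` is a `3`-adic unit (a bit of the TWIST pair) then the cell's typed UPPER
half `Typed.MissingUpperBoundAt W 3` holds for the additive curve `W`; if both `#Ш_an(V)` and
`#Ш_an(W)` are `3`-adic units then `BSD(W,3)` and `BSD(V,3)` (Miller) hold. Census (N < 2·10⁴):
X3 ∧ (G-ord, e = 2) ∧ `p = 3` ∧ ranks `(0,0)`: 79 CORE-open pairs, 78 doubly-unit. Nothing is booked.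
-/

noncomputable section

open scoped Classical MatrixGroups ModularForm

open CongruenceSubgroup WeierstrassCurve NumberField IsDedekindDomain
  Literature.NumberTheory.EllipticCurves Literature.NumberTheory.EllipticCurves.ModularForms
  Literature.NumberTheory.EllipticCurves.Rank1Residual
  Literature.NumberTheory.EllipticCurves.Rank1Residual.Typed
  Literature.NumberTheory.GaloisRepresentations

namespace Summit.BirchSwinnertonDyer.Rank1Residual.Additive

section Corollaries

variable (K : Type) [Field K] [NumberField K] [IsCyclotomicExtension {3} ℚ K]
  (V : WeierstrassCurve ℚ) [V.IsElliptic] [V.IsGloballyMinimal]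
  (W : WeierstrassCurve ℚ) [W.IsElliptic] [W.IsGloballyMinimal]

/-- **Corollary 1 (the cell's typed UPPER half for the additive curve).** In the situation of
`X3CyclotomicThree.exists_padicVal_shaOrder_add_le`, if `#Ш_an(V)` has non-positive `3`-adic
valuation (e.g. is a `3`-adic unit — the census bit `3 ∤ #Ш_an(V)` of the TWIST pair `(V, 3)`), then
`ord₃ #Ш(W) ≤ ord₃ #Ш_an(W)`, i.e. `Typed.MissingUpperBoundAt W 3` — with NO typed input of the cell.
[cite: Wuthrich2014, Thm. 16 (p. 397)] [cite: GreenbergLNM1716, Thm. 4.1 (p. 102)] -/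
theorem X3CyclotomicThree.missingUpperBoundAt_of_twist_shaAn
    (hGZK : rank_eq_analyticRank_of_analyticRank_le_one) (hmod : hasEntireLFunction_rat)
    (hMilne : Milne1972.bsdQuotient_baseChange_quadratic_anyModel)
    (C : VariableChange ℚ) (hC : C • V.quadraticTwist (-(3 : ℚ)) = W)
    (hord : IsOrdinaryAt V 3) (hadd : Addv W 3)
    (hrV : V.analyticRank = 0) (hrW : W.analyticRank = 0)
    {N : ℕ} [NeZero N] {f : CuspForm (Gamma0 N) 2} (hf : IsNewformOf V f)
    (ϖ ϖ' : ℚ) (hϖ : (ϖ : ℝ) * V.realPeriodRat = plusPeriod f)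
    (hϖ' : (ϖ' : ℝ) * V.imaginaryPeriodRat = minusPeriod f)
    (hexK : ∃ κ : ZpExtension K 3, κ.IsCyclotomic ∧ ∃ γ : Field.absoluteGaloisGroup K,
      κ.IsTopGenerator γ ∧ ∃ ζ : ℤ_[3]ˣ, IsOfFinOrder ζ ∧
        ((GaloisRep.cyclotomicCharacter K 3 γ * ζ : ℤ_[3]ˣ) : ℤ_[3]) = (cyclotomicGenerator 3 : ℤ_[3]))
    (hW16K : ∀ (κ : ZpExtension K 3) (γ : Field.absoluteGaloisGroup K),
      κ.IsCyclotomic → κ.IsTopGenerator γ →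
      (∃ ζ : ℤ_[3]ˣ, IsOfFinOrder ζ ∧
        ((GaloisRep.cyclotomicCharacter K 3 γ * ζ : ℤ_[3]ˣ) : ℤ_[3]) = (cyclotomicGenerator 3 : ℤ_[3])) →
      ∀ D : (V.baseChange K).SelmerDualData κ γ,
        D.IsTorsion ∧ ∃ g ∈ D.charIdeal, ∃ u : ℤ_[3]ˣ,
          iwasawaToPowerSeries 3 g =
            PowerSeries.C (((u : ℤ_[3]) : ℚ_[3]) * (ϖ : ℚ_[3]) * (ϖ' : ℚ_[3])) *
              (padicLFunction f ((unitRoot V 3 : ℤ_[3]) : ℚ_[3]) *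
                padicLFunctionMinusBranch f ((unitRoot V 3 : ℤ_[3]) : ℚ_[3]) 1))
    (hGrK : ∀ (κ : ZpExtension K 3) (γ : Field.absoluteGaloisGroup K),
        κ.IsCyclotomic → κ.IsTopGenerator γ →
      ∀ (D : (V.baseChange K).SelmerDualData κ γ) [Module.Finite (IwasawaAlgebra 3) D.X], D.IsTorsion →
      ∀ (fE : IwasawaAlgebra 3), D.charIdeal = Ideal.span {fE} →
        Finite ((V.baseChange K).selmerGroupPInfty 3) →
        ∃ u : ℤ_[3]ˣ,
          ((PowerSeries.constantCoeff fE : ℤ_[3]) : ℚ_[3]) *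
              (Nat.card (AddCommGroup.primaryComponent (V.baseChange K).toAffine.Point 3) : ℚ_[3]) ^ 2 =
            ((u : ℤ_[3]) : ℚ_[3]) * (3 : ℚ_[3]) ^ (padicValNat 3 (V.baseChange K).tamagawaProduct) *
              (Nat.card (AddCommGroup.primaryComponent
                ((integralModelInt V).map (Int.castRingHom (ZMod 3))).toAffine.Point 3) : ℚ_[3]) ^ 2 *
              (Nat.card ((V.baseChange K).selmerGroupPInfty 3) : ℚ_[3]))
    {qV : ℚ} (hqV : shaAn V = (qV : ℂ)) (hv : padicValRat 3 qV ≤ 0) :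
    MissingUpperBoundAt W 3 := by
  obtain ⟨qV', qW, hqV', hqW, hle⟩ := X3CyclotomicThree.exists_padicVal_shaOrder_add_le K V W hGZK
    hmod hMilne C hC hord hadd hrV hrW hf ϖ ϖ' hϖ hϖ' hexK hW16K hGrK
    (constantCoeff_padicLFunctionMinusBranch_one_three V hord hf)
  have hqq : qV' = qV := by exact_mod_cast hqV'.symm.trans hqV
  subst hqq
  refine ⟨qW, hqW, ?_⟩
  have h0 : (0 : ℤ) ≤ padicValNat 3 V.shaOrder := by positivity
  linarith

/-- **Corollary 2 (`BSD(W,3)` AND `BSD(V,3)` on the doubly-unit rows).** In the situation of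
`X3CyclotomicThree.exists_padicVal_shaOrder_add_le`, if BOTH `#Ш_an(V)` and `#Ш_an(W)` are `3`-adic
units then `ord₃ #Ш(V) = ord₃ #Ш(W) = 0` and Miller's `BSD(W,3)`, `BSD(V,3)` hold — for the ADDITIVE
X3 pair `(W, 3)` (type `I₀*`, `W[3]` reducible) and its good ordinary Eisenstein twist pair `(V, 3)`
simultaneously. Census (cell `b2b-bsdres`, N < 2·10⁴): X3 ∧ (G-ord, e = 2) ∧ `p = 3` ∧
`(r_an(W), r_an(V)) = (0,0)`: 79 CORE-open pairs, 78 of them doubly-unit. Inputs: Wuthrich Thm. 16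
read over `K` (`hW16K`), Greenberg Thm. 4.1 over `K` (`hGrK`), the
`K`-cyclotomic setting (`hexK`), Milne 1972 (`hMilne`), GZK, modularity — nothing else; the labels of
X3/X1 are NOT changed by this file (booking is the referee's call).
[cite: Wuthrich2014, Thm. 16 (p. 397)] [cite: GreenbergLNM1716, Thm. 4.1 (p. 102)] -/
theorem X3CyclotomicThree.bsdp_of_shaAn_units
    (hGZK : rank_eq_analyticRank_of_analyticRank_le_one) (hmod : hasEntireLFunction_rat)
    (hMilne : Milne1972.bsdQuotient_baseChange_quadratic_anyModel)
    (C : VariableChange ℚ) (hC : C • V.quadraticTwist (-(3 : ℚ)) = W)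
    (hord : IsOrdinaryAt V 3) (hadd : Addv W 3)
    (hrV : V.analyticRank = 0) (hrW : W.analyticRank = 0)
    {N : ℕ} [NeZero N] {f : CuspForm (Gamma0 N) 2} (hf : IsNewformOf V f)
    (ϖ ϖ' : ℚ) (hϖ : (ϖ : ℝ) * V.realPeriodRat = plusPeriod f)
    (hϖ' : (ϖ' : ℝ) * V.imaginaryPeriodRat = minusPeriod f)
    (hexK : ∃ κ : ZpExtension K 3, κ.IsCyclotomic ∧ ∃ γ : Field.absoluteGaloisGroup K,
      κ.IsTopGenerator γ ∧ ∃ ζ : ℤ_[3]ˣ, IsOfFinOrder ζ ∧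
        ((GaloisRep.cyclotomicCharacter K 3 γ * ζ : ℤ_[3]ˣ) : ℤ_[3]) = (cyclotomicGenerator 3 : ℤ_[3]))
    (hW16K : ∀ (κ : ZpExtension K 3) (γ : Field.absoluteGaloisGroup K),
      κ.IsCyclotomic → κ.IsTopGenerator γ →
      (∃ ζ : ℤ_[3]ˣ, IsOfFinOrder ζ ∧
        ((GaloisRep.cyclotomicCharacter K 3 γ * ζ : ℤ_[3]ˣ) : ℤ_[3]) = (cyclotomicGenerator 3 : ℤ_[3])) →
      ∀ D : (V.baseChange K).SelmerDualData κ γ,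
        D.IsTorsion ∧ ∃ g ∈ D.charIdeal, ∃ u : ℤ_[3]ˣ,
          iwasawaToPowerSeries 3 g =
            PowerSeries.C (((u : ℤ_[3]) : ℚ_[3]) * (ϖ : ℚ_[3]) * (ϖ' : ℚ_[3])) *
              (padicLFunction f ((unitRoot V 3 : ℤ_[3]) : ℚ_[3]) *
                padicLFunctionMinusBranch f ((unitRoot V 3 : ℤ_[3]) : ℚ_[3]) 1))
    (hGrK : ∀ (κ : ZpExtension K 3) (γ : Field.absoluteGaloisGroup K),
        κ.IsCyclotomic → κ.IsTopGenerator γ →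
      ∀ (D : (V.baseChange K).SelmerDualData κ γ) [Module.Finite (IwasawaAlgebra 3) D.X], D.IsTorsion →
      ∀ (fE : IwasawaAlgebra 3), D.charIdeal = Ideal.span {fE} →
        Finite ((V.baseChange K).selmerGroupPInfty 3) →
        ∃ u : ℤ_[3]ˣ,
          ((PowerSeries.constantCoeff fE : ℤ_[3]) : ℚ_[3]) *
              (Nat.card (AddCommGroup.primaryComponent (V.baseChange K).toAffine.Point 3) : ℚ_[3]) ^ 2 =
            ((u : ℤ_[3]) : ℚ_[3]) * (3 : ℚ_[3]) ^ (padicValNat 3 (V.baseChange K).tamagawaProduct) *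
              (Nat.card (AddCommGroup.primaryComponent
                ((integralModelInt V).map (Int.castRingHom (ZMod 3))).toAffine.Point 3) : ℚ_[3]) ^ 2 *
              (Nat.card ((V.baseChange K).selmerGroupPInfty 3) : ℚ_[3]))
    {qV qW : ℚ} (hqV : shaAn V = (qV : ℂ)) (hqW : shaAn W = (qW : ℂ))
    (hvV : padicValRat 3 qV = 0) (hvW : padicValRat 3 qW = 0) : BSDp W 3 ∧ BSDp V 3 := by
  obtain ⟨qV', qW', hqV', hqW', hle⟩ := X3CyclotomicThree.exists_padicVal_shaOrder_add_le K V W hGZK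
    hmod hMilne C hC hord hadd hrV hrW hf ϖ ϖ' hϖ hϖ' hexK hW16K hGrK
    (constantCoeff_padicLFunctionMinusBranch_one_three V hord hf)
  have hqq : qV' = qV := by exact_mod_cast hqV'.symm.trans hqV
  have hqq' : qW' = qW := by exact_mod_cast hqW'.symm.trans hqW
  subst hqq hqq'
  rw [hvV, hvW, add_zero] at hle
  have hV0 : (0 : ℤ) ≤ padicValNat 3 V.shaOrder := by positivity
  have hW0 : (0 : ℤ) ≤ padicValNat 3 W.shaOrder := by positivity
  have huW : MissingUpperBoundAt W 3 := ⟨qW', hqW', by rw [hvW]; linarith⟩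
  have huV : MissingUpperBoundAt V 3 := ⟨qV', hqV', by rw [hvV]; linarith⟩
  exact ⟨bsdp_of_missingPPartAt W 3 hGZK (by rw [hrW]; exact zero_le_one)
      (missingPPartAt_of_upper_of_shaAn_unit W 3 huW hqW' hvW),
    bsdp_of_missingPPartAt V 3 hGZK (by rw [hrV]; exact zero_le_one)
      (missingPPartAt_of_upper_of_shaAn_unit V 3 huV hqV' hvV)⟩


/-! ### The same, with Wuthrich's theorem as the NAMED FACT and the newform supplied by modularity -/

/-- **Line V14 from the named fact** `Wuthrich2014.charIdeal_dvd_padicLFunction_cyclotomicThree`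
(p206900; Wuthrich 2014 Thm. 16 at `p = 3` read over `K = ℚ(ζ₃)`) and a modular parametrisation of
`V` (`hmodD`: the newform `f`, `ϖ = Ω⁺_f/Ω_V`, `ϖ' = Ω⁻_f/|Ω⁻(V)|` — both rational, tree theorems
`ModularParametrizationData.exists_rat_mul_realPeriodRat_eq_plusPeriod`,
`exists_rat_mul_imaginaryPeriodRat_eq_minusPeriod`): for `V` globally minimal, good ordinary at `3`
with `V[3]` REDUCIBLE, `W = C • V^{(−3)}` additive at `3`, both of analytic rank `0`, granted over `K`
Greenberg's Thm. 4.1 (`hGrK`) and the cyclotomic setting (`hexK`) — the odd-branch constant term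
being now a THEOREM (`constantCoeff_padicLFunctionMinusBranch_one_three`, file
`ChiBranchConstantTermOdd`): `#Ш_an(V) = q_V`, `#Ш_an(W) = q_W` with
`ord₃ #Ш(V) + ord₃ #Ш(W) ≤ ord₃ q_V + ord₃ q_W`.
[cite: Wuthrich2014, Thm. 16 (p. 397)] [cite: GreenbergLNM1716, Thm. 4.1 (p. 102)] -/
theorem X3CyclotomicThree.exists_padicVal_shaOrder_add_le_of_fact
    (hW16 : Wuthrich2014.charIdeal_dvd_padicLFunction_cyclotomicThree)
    (hGZK : rank_eq_analyticRank_of_analyticRank_le_one) (hmod : hasEntireLFunction_rat)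
    (hmodD : nonempty_modularParametrizationData)
    (hMilne : Milne1972.bsdQuotient_baseChange_quadratic_anyModel)
    (C : VariableChange ℚ) (hC : C • V.quadraticTwist (-(3 : ℚ)) = W)
    (hord : IsOrdinaryAt V 3) (hred : ¬ V.HasIrreducibleModPGaloisRep 3) (hadd : Addv W 3)
    (hrV : V.analyticRank = 0) (hrW : W.analyticRank = 0)
    (hexK : ∃ κ : ZpExtension K 3, κ.IsCyclotomic ∧ ∃ γ : Field.absoluteGaloisGroup K,
      κ.IsTopGenerator γ ∧ ∃ ζ : ℤ_[3]ˣ, IsOfFinOrder ζ ∧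
        ((GaloisRep.cyclotomicCharacter K 3 γ * ζ : ℤ_[3]ˣ) : ℤ_[3]) = (cyclotomicGenerator 3 : ℤ_[3]))
    (hGrK : ∀ (κ : ZpExtension K 3) (γ : Field.absoluteGaloisGroup K),
        κ.IsCyclotomic → κ.IsTopGenerator γ →
      ∀ (D : (V.baseChange K).SelmerDualData κ γ) [Module.Finite (IwasawaAlgebra 3) D.X], D.IsTorsion →
      ∀ (fE : IwasawaAlgebra 3), D.charIdeal = Ideal.span {fE} →
        Finite ((V.baseChange K).selmerGroupPInfty 3) →
        ∃ u : ℤ_[3]ˣ,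
          ((PowerSeries.constantCoeff fE : ℤ_[3]) : ℚ_[3]) *
              (Nat.card (AddCommGroup.primaryComponent (V.baseChange K).toAffine.Point 3) : ℚ_[3]) ^ 2 =
            ((u : ℤ_[3]) : ℚ_[3]) * (3 : ℚ_[3]) ^ (padicValNat 3 (V.baseChange K).tamagawaProduct) *
              (Nat.card (AddCommGroup.primaryComponent
                ((integralModelInt V).map (Int.castRingHom (ZMod 3))).toAffine.Point 3) : ℚ_[3]) ^ 2 *
              (Nat.card ((V.baseChange K).selmerGroupPInfty 3) : ℚ_[3])) :
    ∃ qV qW : ℚ, shaAn V = (qV : ℂ) ∧ shaAn W = (qW : ℂ) ∧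
      (padicValNat 3 V.shaOrder : ℤ) + padicValNat 3 W.shaOrder ≤ padicValRat 3 qV + padicValRat 3 qW := by
  -- the newform and the two rational period ratios
  haveI : NeZero (V.conductorNorm ℤ) := ⟨(V.conductorNorm_pos_holds).ne'⟩
  obtain ⟨Dm⟩ := hmodD V
  have hf : IsNewformOf V Dm.f := Dm.isNewformOf
  obtain ⟨ϖ, -, hϖ, -⟩ := Dm.exists_rat_mul_realPeriodRat_eq_plusPeriod
  obtain ⟨ϖ', -, hϖ'⟩ := exists_rat_mul_imaginaryPeriodRat_eq_minusPeriod Dm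
  refine X3CyclotomicThree.exists_padicVal_shaOrder_add_le K V W hGZK hmod hMilne C hC hord hadd hrV hrW
    hf ϖ ϖ' hϖ hϖ' hexK (fun κ γ hκ hγ hγ' D ↦ ?_) hGrK
    (constantCoeff_padicLFunctionMinusBranch_one_three V hord hf)
  exact hW16 V K (V.baseChange K) hord hred ⟨1, one_smul _ _⟩ hκ hγ hγ' hf D ϖ ϖ' hϖ hϖ'

/-- **`BSD(W,3) ∧ BSD(V,3)` on the doubly-unit rows, from the named fact** (same inputs as
`X3CyclotomicThree.exists_padicVal_shaOrder_add_le_of_fact`): if `#Ш_an(V)` and `#Ш_an(W)` are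
`3`-adic units then Miller's `BSD(W,3)` and `BSD(V,3)` hold. The 78 doubly-unit CORE-open X3 pairs at
`p = 3` of the census are of this shape; nothing is booked by this theorem.
[cite: Wuthrich2014, Thm. 16 (p. 397)] [cite: GreenbergLNM1716, Thm. 4.1 (p. 102)] -/
theorem X3CyclotomicThree.bsdp_of_shaAn_units_of_fact
    (hW16 : Wuthrich2014.charIdeal_dvd_padicLFunction_cyclotomicThree)
    (hGZK : rank_eq_analyticRank_of_analyticRank_le_one) (hmod : hasEntireLFunction_rat)
    (hmodD : nonempty_modularParametrizationData)
    (hMilne : Milne1972.bsdQuotient_baseChange_quadratic_anyModel)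
    (C : VariableChange ℚ) (hC : C • V.quadraticTwist (-(3 : ℚ)) = W)
    (hord : IsOrdinaryAt V 3) (hred : ¬ V.HasIrreducibleModPGaloisRep 3) (hadd : Addv W 3)
    (hrV : V.analyticRank = 0) (hrW : W.analyticRank = 0)
    (hexK : ∃ κ : ZpExtension K 3, κ.IsCyclotomic ∧ ∃ γ : Field.absoluteGaloisGroup K,
      κ.IsTopGenerator γ ∧ ∃ ζ : ℤ_[3]ˣ, IsOfFinOrder ζ ∧
        ((GaloisRep.cyclotomicCharacter K 3 γ * ζ : ℤ_[3]ˣ) : ℤ_[3]) = (cyclotomicGenerator 3 : ℤ_[3]))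
    (hGrK : ∀ (κ : ZpExtension K 3) (γ : Field.absoluteGaloisGroup K),
        κ.IsCyclotomic → κ.IsTopGenerator γ →
      ∀ (D : (V.baseChange K).SelmerDualData κ γ) [Module.Finite (IwasawaAlgebra 3) D.X], D.IsTorsion →
      ∀ (fE : IwasawaAlgebra 3), D.charIdeal = Ideal.span {fE} →
        Finite ((V.baseChange K).selmerGroupPInfty 3) →
        ∃ u : ℤ_[3]ˣ,
          ((PowerSeries.constantCoeff fE : ℤ_[3]) : ℚ_[3]) *
              (Nat.card (AddCommGroup.primaryComponent (V.baseChange K).toAffine.Point 3) : ℚ_[3]) ^ 2 =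
            ((u : ℤ_[3]) : ℚ_[3]) * (3 : ℚ_[3]) ^ (padicValNat 3 (V.baseChange K).tamagawaProduct) *
              (Nat.card (AddCommGroup.primaryComponent
                ((integralModelInt V).map (Int.castRingHom (ZMod 3))).toAffine.Point 3) : ℚ_[3]) ^ 2 *
              (Nat.card ((V.baseChange K).selmerGroupPInfty 3) : ℚ_[3]))
    {qV qW : ℚ} (hqV : shaAn V = (qV : ℂ)) (hqW : shaAn W = (qW : ℂ))
    (hvV : padicValRat 3 qV = 0) (hvW : padicValRat 3 qW = 0) : BSDp W 3 ∧ BSDp V 3 := by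
  obtain ⟨qV', qW', hqV', hqW', hle⟩ := X3CyclotomicThree.exists_padicVal_shaOrder_add_le_of_fact K V W
    hW16 hGZK hmod hmodD hMilne C hC hord hred hadd hrV hrW hexK hGrK
  have hqq : qV' = qV := by exact_mod_cast hqV'.symm.trans hqV
  have hqq' : qW' = qW := by exact_mod_cast hqW'.symm.trans hqW
  subst hqq hqq'
  rw [hvV, hvW, add_zero] at hle
  have hV0 : (0 : ℤ) ≤ padicValNat 3 V.shaOrder := by positivity
  have hW0 : (0 : ℤ) ≤ padicValNat 3 W.shaOrder := by positivity
  have huW : MissingUpperBoundAt W 3 := ⟨qW', hqW', by rw [hvW]; linarith⟩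
  have huV : MissingUpperBoundAt V 3 := ⟨qV', hqV', by rw [hvV]; linarith⟩
  exact ⟨bsdp_of_missingPPartAt W 3 hGZK (by rw [hrW]; exact zero_le_one)
      (missingPPartAt_of_upper_of_shaAn_unit W 3 huW hqW' hvW),
    bsdp_of_missingPPartAt V 3 hGZK (by rw [hrV]; exact zero_le_one)
      (missingPPartAt_of_upper_of_shaAn_unit V 3 huV hqV' hvV)⟩

end Corollaries

end Summit.BirchSwinnertonDyer.Rank1Residual.Additive

end
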